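import Summits.QuantumFields.YangMills.Theorems.BalabanUVNodesN12WindowNearRegionGeometry
import HarnessLib

/-!
# BalabanUVNodes ∕ N12 — THE GRADED LETTERS NEAR THE WINDOW: the plaquettes of the iterated averages around a WINDOW-NEAR member segment decay geometrically below the window's level from ONE
# class ∕ [15]-Thm-1 letter at level `k − 1`; the tower budgets then close `k`-UNIFORMLY; hence the root transporter of ONE window bond with a `k`-UNIFORM letter `m′·24·(((d+2)L)²∕4)·ε`

Cell `pub-ymgap` (HUMAN RULINGS D-0062 ∕ D-0149), WIDTH SEAT `pub-ymgap-dag-n12-w6` g7 (node N12 = [B15]; key K1⁹ `stmt-QuantumFields-27364`, `--kind proof --supports … --as helper`;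
count-neutral).  THEOREMS ONLY (0 `def`, 0 `instance`, 0 `sorry`).  Composition BY NAME: dag-n11's
local `k`-uniform [Balaban1985Averaging] Prop. 2 (`BalabanUVNodesN11LocalIteratedAveraging.plaqSmallOn_iter_avOfRecord_of_boxClosed`), dag-n12-w3's segment family (`N12SegmentPlaqFamily.family_boxClosed`
∕ `mem_family_of_threeBlocks`), graded root chains (`exists_rootChain_Bj_graded`) and local transporter (`transporter_of_links_local` — used AS IS on the window-near sub-determining-set),
dag-n12-w2's Prop. 1 `BlockAveragingPlaquetteBoundLocal.dist1_corr_le_local`, this seat's `…N12WindowNearRegionGeometry`.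

WHAT.  ★★ `iteratedPlaqLetter_window` — for a level-`i` bond with an end centre reached from `Ω_k` by two short words (collar numerics `hfit`), the plaquettes of `M^j(U₀)` (`j < i`) in the three
blocks around every level-`(j+1)` bond of its segment are `2εL²·(Lʲη_k)²`-small, from `PlaqSmallOn (plaqsOf Ω_{k−1}) (ε·η_{k−1}²) U₀` alone (Prop. 2 with `α₀ := ε·(Lⁱη_k)² ≤ ε`, `η := η_{i−1}`;
dag-n12-w3's `iteratedPlaqLetter_of_family` read two levels below the MEMBER and kept the constant `2εL²`).  ★ `towerBudget_uniform` — with `κ_j = 6·(((d+2)L)²∕4)·2εL²(Lʲη_k)²` the recursion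
`θ_{j+1} = κ_j + L·θ_j` of w6 g1's `T4ForestGaugeCorridorBound` is solved by `θ_j = (6(((d+2)L)²∕4)·2εL²)·η_k²·L^{j−1}·Σ_{i<j}Lⁱ` and `θ_k ≤ 24·(((d+2)L)²∕4)·ε`.  ★ `stokesTerm_uniform_le` —
`((2ℓ_k+1+m′L^k)²∕4)·(ε·η_{k−1}²) ≤ ((4d+m′+3)²L²∕4)·ε`.  ★★★ `rootTransporter_window` — for a fine bond inside `Ω₁(Z)` with source in the window `X` (every point of `X` within `D₀` of `Ω_k`):
the root chain `root b₋ ⇝ root b₊` carries `𝒰_{U₀}(chain)·g⁻¹` with `dist1 ≤ m′·24·(((d+2)L)²∕4)·ε` and `dist1 g ≤ m′·ρn` — the chain's links are members of the WINDOW-NEAR sub-family of `𝐁_k(Z)`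
(reachable from `X` within `ℓ_k + m′L^k + L^k`), on which `transporter_of_links_local` runs with the graded `κ, θ`.

HONEST FRAMING.  Lattice bookkeeping and composition by name over landed kernel theorems; the minimiser ([15] Thm 1 ∕ the lane's (E)), its graded plaquette letter, the region datum, the window
rows and the numerics stay HYPOTHESES; the constants are `C(d, L)` — uniform in the level `k` and in the volume, but NOT print's `O(1)` bookkeeping of [15] (16)–(18) verbatim; nothing of
Bałaban's asserted beyond the cited tree theorems; count-neutral; N12 NOT discharged; K1⁹ NOT closed; counts unmoved (typed 28∕28 · discharged 5∕27); one finite 𝕋⁴ programme at fixed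
`ε = L^{-K}` — R4 closes the conditional rung `BalabanLadder.UV` only; no summit statement is proved here and NOT the Yang–Mills mass gap (Clay); nothing continuum ∕ ℝ⁴ ∕ OS.

References: [Balaban1985Variational] CMP 102 (1985) 277–309, (2)–(4) p.278, Thm 1 (8) p.279, (16)–(18) p.280; [Balaban1985RegularSpaces] CMP 98 (1985), (1.7) p.77, (1.19) p.79;
[Balaban1985Averaging] CMP 98 (1985) 17–51, (19)–(20) p.21, Prop. 2 (52)–(53) p.26; [Balaban1988Convergent] CMP 119 (1988) 243–285, p.255, (2.2) p.255, (2.11)–(2.13) pp.256–257, (2.16)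
p.257; [Balaban1987RG1] CMP 109 (1987), (0.1) p.251; [Balaban1989LargeFieldII] CMP 122 (1989) 355–392, p.357.
-/

noncomputable section

open scoped Matrix.Norms.L2Operator BigOperators

namespace Summit.QuantumFields.YangMills.BalabanUVNodes.N12WindowGradedLetters

open Literature.MathematicalPhysics.QuantumFieldTheory.Balaban1983to89
open T4Continuum GaugeField B15DeterminingSets BlockAveraging
open T4CubeChartGnomonic (SU2)
open B16Sect1Backgrounds (toMS)
open T4AxialGaugeSmallField (boxPlaqs castSite)
open B14.Eq213MaximalDomains (side)
open B14.Eq213DetSet (Bj maxDomT maxDomT_antitone dist_maxDomT)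
open B14.Eq216Concrete (inputs)
open B14.Eq22Determines (blockIter)
open B14DomainGeom (Within Pt)
open B15Eq112TorusCover (cover lift cover_lift cover_apply)
open B5Eq118OneStroke (iterBlockOf)
open B8Eq17ClassAkV1 (plaqsOf)
open ExpMeanLog (expMeanLogSU deltaSU)
open Literature.MathematicalPhysics.QuantumFieldTheory.BalabanImbrieJaffe1984to88.BIJ85Eq453GaugeField (qsstarGIter0)
open LatticeWordCountBox (netDisp_le_count_true neg_count_false_le_netDisp walkEnd_castSite)
open Summit.QuantumFields.YangMills.Theorems.BalabanUVNodesN11LocalIteratedAveraging (plaqSmallOn_iter_avOfRecord_of_boxClosed)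
open Summit.QuantumFields.YangMills.BalabanUVNodes.N12FlatHndRecordLetters (hcov_Bj)
open Summit.QuantumFields.YangMills.BalabanUVNodes.N12RootTransporterBj (theta_mono_of_nonneg)
open Summit.QuantumFields.YangMills.BalabanUVNodes.N12RootTransporterBjLocal (transporter_of_links_local)
open Summit.QuantumFields.YangMills.BalabanUVNodes.N12BjRootChainsGraded (exists_rootChain_Bj_graded)
open Summit.QuantumFields.YangMills.BalabanUVNodes.N12WindowNearRegionGeometry (base_subset_topSeq_window exists_word_endpoints)

variable {P : Params}

/-! ## §1 The plaquettes of the iterated averages around a WINDOW-NEAR member segment, graded from ONE letter at level `k − 1` -/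

/-- ★★ **THE GRADED ITERATED-AVERAGE PLAQUETTE LETTER NEAR THE WINDOW.**  [Balaban1985Averaging] Prop. 2, LOCAL and `k`-uniform (dag-n11's `plaqSmallOn_iter_avOfRecord_of_boxClosed`), applied to
dag-n12-w3's segment family of a level-`i` bond `c` (`1 ≤ i ≤ k`) whose base lies one level below the WINDOW (§3) — so the input is the ONE letter `PlaqSmallOn (plaqsOf Ω_{k−1}) (ε·η_{k−1}²) U₀`
(class ∕ [15] Thm 1 (8) at level `k−1`), read with `α₀ := ε·(Lⁱη_k)² ≤ ε` and `η := η_{i−1}`: the plaquettes of `M^j(U₀)` (`j < i`) in the three blocks around every level-`(j+1)` bond of the segment are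
`2εL²·(Lʲη_k)²`-small — GEOMETRICALLY DECAYING below the window's level instead of dag-n12-w3's constant `2εL²`.
[cite: Balaban1985Averaging, Prop. 2 (52)–(53) p.26; Balaban1985RegularSpaces, (1.7) p.77; Balaban1985Variational, (2) p.278; Balaban1988Convergent, (2.13) pp.256–257] -/
theorem iteratedPlaqLetter_window {F : T4Family} (ν : Node00.Stage7Numerics) (Kt : ℕ) {k : ℕ} (hk1 : 1 ≤ k) (hk : k ≤ (F.P Kt).m + (F.P Kt).K)
    (hM : 1 ≤ ν.M₁) (hdiv : side (F.P Kt).L ν.M₁ k ∣ (F.P Kt).sitesPerDir 0) (Z : Set (Site (F.P Kt) 0))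
    {U₀ : GaugeField (F.P Kt) 0 SU2} {ε : ℝ} (hεpos : 0 < ε)
    (hUk : PlaqSmallOn (plaqsOf (Node00.topSeq (Node00.suppDomOfRecord F ν Kt (maxDomT ν.M₁ Z)) (maxDomT ν.M₁ Z) (k - 1))) (ε * (F.P Kt).eta (k - 1) ^ 2) U₀)
    (hα3 : (143 * (((((F.P Kt).d + 4 : ℕ) : ℝ)) ^ 2 / 4) ^ 2) * (ε * (F.P Kt).L ^ 2) ≤ 1 / 3)
    (hα2 : 2 * (ε * (F.P Kt).L ^ 2) ≤ 2 * deltaSU (Fin 2) / ((((F.P Kt).d + 4) * (F.P Kt).L : ℕ) : ℝ) ^ 2)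
    -- the window-near member: a level-`i` bond with an end centre reached from `Ω_k` by two words, fitting the collar
    {i : ℕ} (hi1 : 1 ≤ i) (hik : i ≤ k) (c : PBond (F.P Kt) i) {y : Site (F.P Kt) i} (hy : y = c.src ∨ y = c.tgt)
    {x₀ x : Site (F.P Kt) 0} (hx₀ : x₀ ∈ maxDomT ν.M₁ Z k) {w₀ w : List (Letter (F.P Kt).d)} (hw₀ : walkEnd x₀ w₀ = x) (hw : walkEnd x w = embIter i y)
    {D₀ D₁ : ℕ} (hD₀ : w₀.length ≤ D₀) (hD₁ : w.length ≤ D₁)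
    (hfit : D₀ + D₁ + (F.P Kt).L ^ i + (3 * (F.P Kt).L ^ i + (((F.P Kt).d + 4) * (F.P Kt).L + 2) * ∑ l ∈ Finset.Ico 0 i, (F.P Kt).L ^ l) + 1 ≤ (F.P Kt).L ^ (k - 1) * ν.M₁) :
    ∀ j < i, ∀ c' : PBond (F.P Kt) (j + 1), c'.dir = c.dir →
      (∃ s < (F.P Kt).L ^ i, embIter (j + 1) c'.src = (fun z : Site (F.P Kt) 0 => z.shift c.dir)^[s] (embIter i c.src)) →
      ∀ q : Plaq (F.P Kt) j, (blockOf q.src = c'.src.unshift c'.dir ∨ blockOf q.src = c'.src ∨ blockOf q.src = c'.tgt) →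
        dist1 (GaugeField.plaqHol (avgFamily (Node00.avOfRecord F 2 Kt) U₀ j) q) < 2 * (ε * (F.P Kt).L ^ 2) * (((F.P Kt).L : ℝ) ^ j * (F.P Kt).eta k) ^ 2 := by
  classical
  intro j hj c' hdir hs q hq
  have hL1 : (1 : ℝ) ≤ (F.P Kt).L := by exact_mod_cast (F.P Kt).L_pos
  have hL0 : (0 : ℝ) < (F.P Kt).L := by linarith
  -- dag-n12-w3's segment family of `c`
  let S : (j : ℕ) → Set (Plaq (F.P Kt) j) := fun j => {q | ∀ ν', ∃ E : ℤ,
    |E| ≤ ((3 * (F.P Kt).L ^ i + (((F.P Kt).d + 4) * (F.P Kt).L + 2) * ∑ l ∈ Finset.Ico j i, (F.P Kt).L ^ l : ℕ) : ℤ) ∧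
      embIter j q.src ν' = embIter i c.src ν' + (E : ZMod ((F.P Kt).sitesPerDir 0))}
  have hSclosed : ∀ j', j' < i - 1 → ∀ p ∈ S (j' + 1), (↑(N20LCSAvgDominationRegion.boxRegion (emb p.src) (((F.P Kt).d + 4) * (F.P Kt).L + 2)) : Set (Plaq (F.P Kt) j')) ⊆ S j' :=
    fun j' hj' p hp q' hq' => N12SegmentPlaqFamily.family_boxClosed (by omega) (hik.trans hk) _ (embIter i c.src) hp hq'
  have hq' : q ∈ S j := N12SegmentPlaqFamily.mem_family_of_threeBlocks hj (hik.trans hk) _ hdir hs hq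
  -- the base one level below the window (§3)
  have hbase : S 0 ⊆ plaqsOf (Node00.topSeq (Node00.suppDomOfRecord F ν Kt (maxDomT ν.M₁ Z)) (maxDomT ν.M₁ Z) (k - 1)) :=
    fun q₀ hq₀ => base_subset_topSeq_window ν Kt hk1 le_rfl hk hM hdiv Z hik c hy hx₀ hw₀ hw hD₀ hD₁ hfit hq₀
  -- Prop. 2 with `α₀ := ε·(Lⁱη_k)²`, depth `i − 1`
  set α₀ : ℝ := ε * (((F.P Kt).L : ℝ) ^ i * (F.P Kt).eta k) ^ 2 with hα₀
  have hratio_i : (((F.P Kt).L : ℝ) ^ i * (F.P Kt).eta k) ^ 2 ≤ 1 := by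
    have h1 : ((F.P Kt).L : ℝ) ^ i * (F.P Kt).eta k ≤ 1 := by
      unfold Params.eta
      rw [inv_pow, ← div_eq_mul_inv, div_le_one (pow_pos hL0 _)]
      exact pow_le_pow_right₀ hL1 hik
    have h0 : 0 ≤ ((F.P Kt).L : ℝ) ^ i * (F.P Kt).eta k := by unfold Params.eta; positivity
    nlinarith
  have hα₀pos : 0 < α₀ := by rw [hα₀]; unfold Params.eta; positivity
  have hα₀le : α₀ ≤ ε * (F.P Kt).L ^ 2 := by
    have hL2 : (1 : ℝ) ≤ ((F.P Kt).L : ℝ) ^ 2 := one_le_pow₀ hL1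
    rw [hα₀]; nlinarith [hεpos.le]
  have hα3' : (143 * (((((F.P Kt).d + 4 : ℕ) : ℝ)) ^ 2 / 4) ^ 2) * α₀ ≤ 1 / 3 :=
    (mul_le_mul_of_nonneg_left hα₀le (by positivity)).trans hα3
  have hα2' : 2 * α₀ ≤ 2 * deltaSU (Fin 2) / ((((F.P Kt).d + 4) * (F.P Kt).L : ℕ) : ℝ) ^ 2 := by linarith
  -- the base tolerance: `α₀·η_{i−1}² = ε·η_{k−1}²`
  have heta : α₀ * (F.P Kt).eta (i - 1) ^ 2 = ε * (F.P Kt).eta (k - 1) ^ 2 := by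
    obtain ⟨n, rfl⟩ : ∃ n, i = n + 1 := ⟨i - 1, by omega⟩
    obtain ⟨m, rfl⟩ : ∃ m, k = m + 1 := ⟨k - 1, by omega⟩
    rw [hα₀, Nat.add_sub_cancel, Nat.add_sub_cancel]
    unfold Params.eta
    have hLne : ((F.P Kt).L : ℝ) ≠ 0 := hL0.ne'
    simp only [inv_pow]
    field_simp
    ring
  have h52 : PlaqSmallOn (S 0) (α₀ * (F.P Kt).eta (i - 1) ^ 2) U₀ := fun p hp => by rw [heta]; exact hUk p (hbase hp)
  have h53 := plaqSmallOn_iter_avOfRecord_of_boxClosed F 2 Kt (i - 1) S hSclosed hα₀pos hα3' hα2' h52 (j := j) (by omega)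
  have hq53 := h53 q hq'
  -- `α₀·(Lʲη_{i−1})² = εL²·(Lʲη_k)²`
  have hout : 2 * α₀ * (((F.P Kt).L : ℝ) ^ j * (F.P Kt).eta (i - 1)) ^ 2 = 2 * (ε * (F.P Kt).L ^ 2) * (((F.P Kt).L : ℝ) ^ j * (F.P Kt).eta k) ^ 2 := by
    obtain ⟨n, rfl⟩ : ∃ n, i = n + 1 := ⟨i - 1, by omega⟩
    rw [hα₀, Nat.add_sub_cancel]
    unfold Params.eta
    have hLne : ((F.P Kt).L : ℝ) ≠ 0 := hL0.ne'
    simp only [inv_pow]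
    field_simp
    ring
  rw [← hout]
  exact hq53

/-! ## §2 The tower budgets close `k`-uniformly; the Stokes term is `k`-uniform -/

/-- The tower budgets fed by the geometrically graded plaquette letter close `k`-UNIFORMLY: with `κ_j = 6·(((d+2)L)²∕4)·(2εL²·(Lʲη_k)²)` the recursion `θ_{j+1} = κ_j + L·θ_j`, `θ_0 = 0`, has
`θ_j = (6·(((d+2)L)²∕4)·2εL²)·η_k²·L^{j−1}·Σ_{i<j}Lⁱ` and `θ_k ≤ 24·(((d+2)L)²∕4)·ε`. [cite: Balaban1985Variational, (16)–(18) p.280 (bookkeeping of the tower sum)] -/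
theorem towerBudget_uniform (hL : 2 ≤ P.L) {k : ℕ} (hk1 : 1 ≤ k) {ε : ℝ} (hε : 0 ≤ ε) :
    (0 ≤ (fun j : ℕ => 6 * (((((P.d + 2) * P.L : ℕ) : ℝ) ^ 2 / 4) * (2 * (ε * (P.L : ℝ) ^ 2))) * P.eta k ^ 2 / P.L * (P.L : ℝ) ^ j * ∑ i ∈ Finset.range j, (P.L : ℝ) ^ i) 0) ∧
    (∀ j : ℕ, 6 * ((((((P.d + 2) * P.L : ℕ) : ℝ) ^ 2 / 4) * (2 * (ε * (P.L : ℝ) ^ 2) * ((P.L : ℝ) ^ j * P.eta k) ^ 2))) +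
        (P.L : ℝ) * (fun j : ℕ => 6 * (((((P.d + 2) * P.L : ℕ) : ℝ) ^ 2 / 4) * (2 * (ε * (P.L : ℝ) ^ 2))) * P.eta k ^ 2 / P.L * (P.L : ℝ) ^ j * ∑ i ∈ Finset.range j, (P.L : ℝ) ^ i) j ≤
        (fun j : ℕ => 6 * (((((P.d + 2) * P.L : ℕ) : ℝ) ^ 2 / 4) * (2 * (ε * (P.L : ℝ) ^ 2))) * P.eta k ^ 2 / P.L * (P.L : ℝ) ^ j * ∑ i ∈ Finset.range j, (P.L : ℝ) ^ i) (j + 1)) ∧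
    (fun j : ℕ => 6 * (((((P.d + 2) * P.L : ℕ) : ℝ) ^ 2 / 4) * (2 * (ε * (P.L : ℝ) ^ 2))) * P.eta k ^ 2 / P.L * (P.L : ℝ) ^ j * ∑ i ∈ Finset.range j, (P.L : ℝ) ^ i) k ≤
      24 * (((((P.d + 2) * P.L : ℕ) : ℝ) ^ 2 / 4) * ε) := by
  have hL0 : (0 : ℝ) < P.L := by exact_mod_cast (show 0 < P.L by omega)
  have hLne : (P.L : ℝ) ≠ 0 := hL0.ne'
  refine ⟨by simp, fun j => le_of_eq ?_, ?_⟩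
  · simp only [Finset.sum_range_succ, pow_succ, mul_pow]
    unfold Params.eta
    simp only [inv_pow]
    field_simp
    ring
  · obtain ⟨n, rfl⟩ : ∃ n, k = n + 1 := ⟨k - 1, by omega⟩
    have hS : ∑ i ∈ Finset.range (n + 1), (P.L : ℝ) ^ i ≤ 2 * (P.L : ℝ) ^ n := by
      have h := N12GaugeLetterLocNumerics.sum_pow_le_two_mul_pow hL n
      exact_mod_cast h
    have hC : 0 ≤ 6 * (((((P.d + 2) * P.L : ℕ) : ℝ) ^ 2 / 4) * (2 * (ε * (P.L : ℝ) ^ 2))) * P.eta (n + 1) ^ 2 / P.L * (P.L : ℝ) ^ (n + 1) := by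
      unfold Params.eta; positivity
    calc 6 * (((((P.d + 2) * P.L : ℕ) : ℝ) ^ 2 / 4) * (2 * (ε * (P.L : ℝ) ^ 2))) * P.eta (n + 1) ^ 2 / P.L * (P.L : ℝ) ^ (n + 1) * ∑ i ∈ Finset.range (n + 1), (P.L : ℝ) ^ i
        ≤ 6 * (((((P.d + 2) * P.L : ℕ) : ℝ) ^ 2 / 4) * (2 * (ε * (P.L : ℝ) ^ 2))) * P.eta (n + 1) ^ 2 / P.L * (P.L : ℝ) ^ (n + 1) * (2 * (P.L : ℝ) ^ n) :=
          mul_le_mul_of_nonneg_left hS hC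
      _ = 24 * (((((P.d + 2) * P.L : ℕ) : ℝ) ^ 2 / 4) * ε) := by
          unfold Params.eta
          simp only [inv_pow, pow_succ]
          field_simp
          ring

/-- ★ **THE STOKES TERM IS `k`-UNIFORM**: `2ℓ_k + 1 + m′L^k ≤ (4d + m′ + 3)·L^k` (`ℓ_k ≤ 2dL^k + k + 1`, `2k + 3 ≤ 3L^k`), hence
`((2ℓ_k+1+m′L^k)²∕4)·(ε·η_{k−1}²) ≤ ((4d+m′+3)²·L²∕4)·ε`. [cite: Balaban1985Variational, (16)–(18) p.280 (bookkeeping)] -/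
theorem stokesTerm_uniform_le (hL : 2 ≤ P.L) {k : ℕ} (hk1 : 1 ≤ k) {ε : ℝ} (hε : 0 ≤ ε) :
    (((2 * (∑ i ∈ Finset.range (k + 1), (P.d * ((P.L ^ i - 1) / 2) + 1)) + 1 + (3 * (P.d * ((P.L - 1) / 2)) + 5) * P.L ^ k : ℕ) : ℝ)) ^ 2 / 4 * (ε * P.eta (k - 1) ^ 2) ≤
      ((((4 * P.d + (3 * (P.d * ((P.L - 1) / 2)) + 5) + 3 : ℕ) : ℝ)) ^ 2 * (P.L : ℝ) ^ 2 / 4) * ε := by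
  have hL0 : (0 : ℝ) < P.L := by exact_mod_cast (show 0 < P.L by omega)
  have hLne : (P.L : ℝ) ≠ 0 := hL0.ne'
  -- the integer bound
  have hN : 2 * (∑ i ∈ Finset.range (k + 1), (P.d * ((P.L ^ i - 1) / 2) + 1)) + 1 + (3 * (P.d * ((P.L - 1) / 2)) + 5) * P.L ^ k ≤ (4 * P.d + (3 * (P.d * ((P.L - 1) / 2)) + 5) + 3) * P.L ^ k := by
    have h1 := N12GaugeLetterLocNumerics.budget_le (P := P) k
    have h2 := N12GaugeLetterLocNumerics.lin_le_three_mul_pow hL k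
    nlinarith
  have hN' : (((2 * (∑ i ∈ Finset.range (k + 1), (P.d * ((P.L ^ i - 1) / 2) + 1)) + 1 + (3 * (P.d * ((P.L - 1) / 2)) + 5) * P.L ^ k : ℕ) : ℝ)) ≤ (((4 * P.d + (3 * (P.d * ((P.L - 1) / 2)) + 5) + 3 : ℕ) : ℝ)) * (P.L : ℝ) ^ k := by
    exact_mod_cast hN
  -- `L^k·η_{k−1} = L`
  obtain ⟨n, rfl⟩ : ∃ n, k = n + 1 := ⟨k - 1, by omega⟩
  have hLeta : (P.L : ℝ) ^ (n + 1) * P.eta (n + 1 - 1) = P.L := by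
    rw [Nat.add_sub_cancel]
    unfold Params.eta
    rw [inv_pow, pow_succ]
    field_simp
  have h0 : (0 : ℝ) ≤ (((2 * (∑ i ∈ Finset.range (n + 1 + 1), (P.d * ((P.L ^ i - 1) / 2) + 1)) + 1 + (3 * (P.d * ((P.L - 1) / 2)) + 5) * P.L ^ (n + 1) : ℕ) : ℝ)) := Nat.cast_nonneg _
  have heta0 : 0 ≤ P.eta (n + 1 - 1) := by unfold Params.eta; positivity
  have hmul : (((2 * (∑ i ∈ Finset.range (n + 1 + 1), (P.d * ((P.L ^ i - 1) / 2) + 1)) + 1 + (3 * (P.d * ((P.L - 1) / 2)) + 5) * P.L ^ (n + 1) : ℕ) : ℝ)) * P.eta (n + 1 - 1) ≤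
      (((4 * P.d + (3 * (P.d * ((P.L - 1) / 2)) + 5) + 3 : ℕ) : ℝ)) * P.L := by
    calc _ ≤ (((4 * P.d + (3 * (P.d * ((P.L - 1) / 2)) + 5) + 3 : ℕ) : ℝ)) * (P.L : ℝ) ^ (n + 1) * P.eta (n + 1 - 1) := mul_le_mul_of_nonneg_right hN' heta0
      _ = (((4 * P.d + (3 * (P.d * ((P.L - 1) / 2)) + 5) + 3 : ℕ) : ℝ)) * P.L := by rw [mul_assoc, hLeta]
  have hsq := mul_self_le_mul_self (mul_nonneg h0 heta0) hmul
  have : (((2 * (∑ i ∈ Finset.range (n + 1 + 1), (P.d * ((P.L ^ i - 1) / 2) + 1)) + 1 + (3 * (P.d * ((P.L - 1) / 2)) + 5) * P.L ^ (n + 1) : ℕ) : ℝ)) ^ 2 / 4 * (ε * P.eta (n + 1 - 1) ^ 2) =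
      ((((2 * (∑ i ∈ Finset.range (n + 1 + 1), (P.d * ((P.L ^ i - 1) / 2) + 1)) + 1 + (3 * (P.d * ((P.L - 1) / 2)) + 5) * P.L ^ (n + 1) : ℕ) : ℝ)) * P.eta (n + 1 - 1)) *
        ((((2 * (∑ i ∈ Finset.range (n + 1 + 1), (P.d * ((P.L ^ i - 1) / 2) + 1)) + 1 + (3 * (P.d * ((P.L - 1) / 2)) + 5) * P.L ^ (n + 1) : ℕ) : ℝ)) * P.eta (n + 1 - 1)) / 4 * ε := by ring
  rw [this]
  have : ((((4 * P.d + (3 * (P.d * ((P.L - 1) / 2)) + 5) + 3 : ℕ) : ℝ)) ^ 2 * (P.L : ℝ) ^ 2 / 4) * ε =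
      ((((4 * P.d + (3 * (P.d * ((P.L - 1) / 2)) + 5) + 3 : ℕ) : ℝ)) * P.L) * ((((4 * P.d + (3 * (P.d * ((P.L - 1) / 2)) + 5) + 3 : ℕ) : ℝ)) * P.L) / 4 * ε := by ring
  rw [this]
  exact mul_le_mul_of_nonneg_right (div_le_div_of_nonneg_right hsq (by norm_num)) hε

/-! ## §3 The root transporter of ONE window bond, its members read at the window's depth -/

/-- ★★ **THE ROOT TRANSPORTER OF ONE WINDOW BOND, `k`-UNIFORM.**  For a fine bond `b` inside `Ω₁(Z)` whose source lies in the window `X` (within `D₀` fine steps of `Ω_k`), the root chain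
`root b₋ ⇝ root b₊` of `𝐁_k(Z)` (dag-n12-w3's `exists_rootChain_Bj_graded`) carries a transporter `𝒰_{U₀}(chain)·g⁻¹` with `dist1 ≤ m′·24·(((d+2)L)²∕4)·ε` — INDEPENDENT OF `k` — and `dist1 g ≤ m′·ρn`,
from: ONE class ∕ [15]-Thm-1 letter at level `k−1`, the (2.12) datum letter at the members reachable from `root b₋` within `m′L^k`, and the collar numerics `hfit`.  Inside: the chain's members
all lie within `ℓ_k + m′L^k + L^k` of the window, so dag-n12-w3's `transporter_of_links_local` runs on the WINDOW-NEAR sub-family of `𝐁_k(Z)` with §4's geometrically graded plaquette letter,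
and the tower budgets close uniformly (`towerBudget_uniform`).
[cite: Balaban1985Variational, (3)–(4) p.278, (16)–(18) p.280; Balaban1985Averaging, (19)–(20) p.21, Prop. 1 (24) p.22, Prop. 2 (52)–(53) p.26; Balaban1988Convergent, (2.12)–(2.13) pp.256–257, (2.16) p.257] -/
theorem rootTransporter_window {F : T4Family} (ν : Node00.Stage7Numerics) (Kt : ℕ) {k : ℕ} (hk1 : 1 ≤ k) (hk : k ≤ (F.P Kt).m + (F.P Kt).K)
    (hM2 : 2 ≤ ν.M₁) (hdiv : side (F.P Kt).L ν.M₁ k ∣ (F.P Kt).sitesPerDir 0) (Z : Set (Site (F.P Kt) 0))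
    (root : Site (F.P Kt) 0 → Site (F.P Kt) 0)
    (hcentre : ∀ (z : Site (F.P Kt) 0) (J : ℕ), iterBlockOf J z ∈ (Bj ν.M₁ Z k : DetSet (F.P Kt)) J →
      ((1 ≤ J ∧ ∃ c ∈ bondsOf ((Bj ν.M₁ Z k : DetSet (F.P Kt)) (J - 1)), (iterBlockOf (J - 1) z = c.src ∨ iterBlockOf (J - 1) z = c.tgt)) ∧
          root z = embIter (J - 1) (iterBlockOf (J - 1) z)) ∨
      (¬ (1 ≤ J ∧ ∃ c ∈ bondsOf ((Bj ν.M₁ Z k : DetSet (F.P Kt)) (J - 1)), (iterBlockOf (J - 1) z = c.src ∨ iterBlockOf (J - 1) z = c.tgt)) ∧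
          root z = embIter J (iterBlockOf J z)))
    {reg : Set (GaugeField (F.P Kt) 0 SU2)} (W : GaugeField (F.P Kt) k SU2) {U₀ : GaugeField (F.P Kt) 0 SU2}
    (hmin : IsMinimizer (Node00.avOfRecord F 2 Kt) reg (Bj ν.M₁ Z k) (avgFamily (Node00.avOfRecord F 2 Kt) (qsstarGIter0 k W)) U₀)
    -- ONE graded plaquette letter at level `k − 1`, Prop. 2-small
    {ε : ℝ} (hεpos : 0 < ε)
    (hUk : PlaqSmallOn (plaqsOf (Node00.topSeq (Node00.suppDomOfRecord F ν Kt (maxDomT ν.M₁ Z)) (maxDomT ν.M₁ Z) (k - 1))) (ε * (F.P Kt).eta (k - 1) ^ 2) U₀)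
    (hα3 : (143 * (((((F.P Kt).d + 4 : ℕ) : ℝ)) ^ 2 / 4) ^ 2) * (ε * (F.P Kt).L ^ 2) ≤ 1 / 3)
    (hα2 : 2 * (ε * (F.P Kt).L ^ 2) ≤ 2 * deltaSU (Fin 2) / ((((F.P Kt).d + 4) * (F.P Kt).L : ℕ) : ℝ) ^ 2)
    (haN : (((((F.P Kt).d + 2) * (F.P Kt).L : ℕ) : ℝ) ^ 2 / 4) * (2 * (ε * (F.P Kt).L ^ 2)) < deltaSU (Fin 2))
    -- the window, within `D₀` of `Ω_k`, and the collar numerics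
    (X : Set (Site (F.P Kt) 0)) {D₀ : ℕ} (hXΩ : ∀ x ∈ X, ∃ x₀ ∈ maxDomT ν.M₁ Z k, ∃ w₀ : List (Letter (F.P Kt).d), w₀.length ≤ D₀ ∧ walkEnd x₀ w₀ = x)
    (hfit : D₀ + ((∑ i ∈ Finset.range (k + 1), ((F.P Kt).d * (((F.P Kt).L ^ i - 1) / 2) + 1)) + (3 * ((F.P Kt).d * (((F.P Kt).L - 1) / 2)) + 5) * (F.P Kt).L ^ k + (F.P Kt).L ^ k) +
      (F.P Kt).L ^ k + (3 * (F.P Kt).L ^ k + (((F.P Kt).d + 4) * (F.P Kt).L + 2) * ∑ l ∈ Finset.Ico 0 k, (F.P Kt).L ^ l) + 1 ≤ (F.P Kt).L ^ (k - 1) * ν.M₁)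
    {ρn : ℝ} (hρn : 0 ≤ ρn)
    -- the bond: source in the window, both ends in `Ω₁(Z)`, its root reached within `ℓ_k`
    (b : PBond (F.P Kt) 0) (hbX : b.src ∈ X) (hbs : b.src ∈ maxDomT ν.M₁ Z 1) (hbt : b.tgt ∈ maxDomT ν.M₁ Z 1)
    {wr : List (Letter (F.P Kt).d)} (hwr : wr.length ≤ ∑ i ∈ Finset.range (k + 1), ((F.P Kt).d * (((F.P Kt).L ^ i - 1) / 2) + 1)) (hwre : walkEnd b.src wr = root b.src)
    -- the datum letter at the members reachable from `root b₋` within `m′L^k`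
    (hWj : ∀ i ≤ k, ∀ c ∈ bondsOf ((Bj ν.M₁ Z k : DetSet (F.P Kt)) i),
      (∃ w : List (Letter (F.P Kt).d), w.length ≤ (3 * ((F.P Kt).d * (((F.P Kt).L - 1) / 2)) + 5) * (F.P Kt).L ^ k ∧
        (walkEnd (root b.src) w = embIter i c.src ∨ walkEnd (root b.src) w = embIter i c.tgt)) →
      dist1 (avgFamily (Node00.avOfRecord F 2 Kt) (qsstarGIter0 k W) i c) ≤ ρn)
    {J : ℕ} (hJ : iterBlockOf J b.src ∈ (Bj ν.M₁ Z k : DetSet (F.P Kt)) J) :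
    ∃ (Ωw : List (Letter (F.P Kt).d)) (g : SU2), walkEnd (root b.src) Ωw = root b.tgt ∧
      Ωw.length ≤ (3 * ((F.P Kt).d * (((F.P Kt).L - 1) / 2)) + 5) * (F.P Kt).L ^ min (J + 1) k ∧
      dist1 (holAt U₀ (walk (root b.src) Ωw) * g⁻¹) ≤ ((3 * ((F.P Kt).d * (((F.P Kt).L - 1) / 2)) + 5 : ℕ) : ℝ) * (24 * ((((((F.P Kt).d + 2) * (F.P Kt).L : ℕ) : ℝ) ^ 2 / 4) * ε)) ∧
      dist1 g ≤ ((3 * ((F.P Kt).d * (((F.P Kt).L - 1) / 2)) + 5 : ℕ) : ℝ) * ρn := by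
  classical
  have hM : 1 ≤ ν.M₁ := by omega
  have hL2 : 2 ≤ (F.P Kt).L := (F.P Kt).hL.2
  have hL1 : (1 : ℝ) ≤ (F.P Kt).L := by exact_mod_cast (F.P Kt).L_pos
  have hL0 : (0 : ℝ) < (F.P Kt).L := by linarith
  -- ### the graded tower budgets
  set κ : ℕ → ℝ := fun j => 6 * ((((((F.P Kt).d + 2) * (F.P Kt).L : ℕ) : ℝ) ^ 2 / 4) * (2 * (ε * ((F.P Kt).L : ℝ) ^ 2) * (((F.P Kt).L : ℝ) ^ j * (F.P Kt).eta k) ^ 2)) with hκ_def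
  set θ : ℕ → ℝ := fun j => 6 * ((((((F.P Kt).d + 2) * (F.P Kt).L : ℕ) : ℝ) ^ 2 / 4) * (2 * (ε * ((F.P Kt).L : ℝ) ^ 2))) * (F.P Kt).eta k ^ 2 / (F.P Kt).L * ((F.P Kt).L : ℝ) ^ j *
    ∑ i ∈ Finset.range j, ((F.P Kt).L : ℝ) ^ i with hθ_def
  obtain ⟨hθ0, hθ, hθk⟩ := towerBudget_uniform (P := F.P Kt) hL2 hk1 hεpos.le
  have hκ0 : ∀ j, 0 ≤ κ j := fun j => by rw [hκ_def]; unfold Params.eta; positivity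
  have hθmono : ∀ i j, i ≤ j → θ i ≤ θ j := fun i j hij => (theta_mono_of_nonneg κ θ hθ0 hκ0 hθ hij).2
  -- ### the window-near sub-family of `𝐁_k(Z)`
  set R₃ : ℕ := (∑ i ∈ Finset.range (k + 1), ((F.P Kt).d * (((F.P Kt).L ^ i - 1) / 2) + 1)) + (3 * ((F.P Kt).d * (((F.P Kt).L - 1) / 2)) + 5) * (F.P Kt).L ^ k + (F.P Kt).L ^ k with hR₃
  let 𝔹' : DetSet (F.P Kt) := fun i => {y | y ∈ (Bj ν.M₁ Z k : DetSet (F.P Kt)) i ∧ ∃ x ∈ X, ∃ w : List (Letter (F.P Kt).d), w.length ≤ R₃ ∧ walkEnd x w = embIter i y}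
  have h𝔹'sub : ∀ i (c : PBond (F.P Kt) i), c ∈ bondsOf (𝔹' i) → c ∈ bondsOf ((Bj ν.M₁ Z k : DetSet (F.P Kt)) i) := fun i c hc => by
    rcases hc with h | h
    · exact Or.inl h.1
    · exact Or.inr h.1
  -- ### the graded corr letter on the sub-family (§4 + [Balaban1985Averaging] Prop. 1)
  have hκ' : ∀ i ≤ k, ∀ c ∈ bondsOf (𝔹' i), ∀ i' < i, ∀ c' : PBond (F.P Kt) (i' + 1), c'.dir = c.dir →
      (∃ t < (F.P Kt).L ^ i, embIter (i' + 1) c'.src = (fun z : Site (F.P Kt) 0 => z.shift c.dir)^[t] (embIter i c.src)) →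
      dist1 (corr (expMeanLogSU (n := Fin 2)) (Averaging.iter (fun i => blockAvg (P := F.P Kt) (j := i) (expMeanLogSU (n := Fin 2))) i' U₀) c') ≤ κ i' := by
    intro i hi c hc i' hi' c' hdir hs
    have hyex : ∃ y : Site (F.P Kt) i, (y = c.src ∨ y = c.tgt) ∧ y ∈ 𝔹' i := by
      rcases hc with h | h
      · exact ⟨_, Or.inl rfl, h⟩
      · exact ⟨_, Or.inr rfl, h⟩
    obtain ⟨y, hy, -, x, hxX, w, hwl, hwe⟩ := hyex
    obtain ⟨x₀, hx₀, w₀, hw₀l, hw₀e⟩ := hXΩ x hxX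
    have hfit_i : D₀ + R₃ + (F.P Kt).L ^ i + (3 * (F.P Kt).L ^ i + (((F.P Kt).d + 4) * (F.P Kt).L + 2) * ∑ l ∈ Finset.Ico 0 i, (F.P Kt).L ^ l) + 1 ≤ (F.P Kt).L ^ (k - 1) * ν.M₁ := by
      have h1 : (F.P Kt).L ^ i ≤ (F.P Kt).L ^ k := Nat.pow_le_pow_right (F.P Kt).L_pos hi
      have h2 : ∑ l ∈ Finset.Ico 0 i, (F.P Kt).L ^ l ≤ ∑ l ∈ Finset.Ico 0 k, (F.P Kt).L ^ l :=
        Finset.sum_le_sum_of_subset (Finset.Ico_subset_Ico_right hi)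
      have h3 := Nat.mul_le_mul_left (((F.P Kt).d + 4) * (F.P Kt).L + 2) h2
      have h4 := hfit
      rw [hR₃]
      omega
    have ha := iteratedPlaqLetter_window ν Kt hk1 hk hM hdiv Z hεpos hUk hα3 hα2 (i := i) (by omega) hi c hy hx₀ hw₀e hwe hw₀l hwl hfit_i i' hi' c' hdir hs
    have hratio : (((F.P Kt).L : ℝ) ^ i' * (F.P Kt).eta k) ^ 2 ≤ 1 := by
      have h1 : ((F.P Kt).L : ℝ) ^ i' * (F.P Kt).eta k ≤ 1 := by
        unfold Params.eta
        rw [inv_pow, ← div_eq_mul_inv, div_le_one (pow_pos hL0 _)]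
        exact pow_le_pow_right₀ hL1 (by omega)
      have h0 : 0 ≤ ((F.P Kt).L : ℝ) ^ i' * (F.P Kt).eta k := by unfold Params.eta; positivity
      nlinarith
    have ha0 : 0 ≤ 2 * (ε * ((F.P Kt).L : ℝ) ^ 2) * (((F.P Kt).L : ℝ) ^ i' * (F.P Kt).eta k) ^ 2 := by positivity
    have haN' : (((((F.P Kt).d + 2) * (F.P Kt).L : ℕ) : ℝ) ^ 2 / 4) * (2 * (ε * ((F.P Kt).L : ℝ) ^ 2) * (((F.P Kt).L : ℝ) ^ i' * (F.P Kt).eta k) ^ 2) < deltaSU (Fin 2) := by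
      refine lt_of_le_of_lt (mul_le_mul_of_nonneg_left ?_ (by positivity)) haN
      have h2 : 0 ≤ 2 * (ε * ((F.P Kt).L : ℝ) ^ 2) := by positivity
      nlinarith
    exact BlockAveragingPlaquetteBoundLocal.dist1_corr_le_local ha0 (by omega) c' ha haN'
  -- ### the datum letter on the sub-family, relative to `root b₋` (the (2.12) constraint)
  have hδ₁' : ∀ i ≤ k, ∀ c ∈ bondsOf (𝔹' i),
      (∃ w : List (Letter (F.P Kt).d), w.length ≤ (3 * ((F.P Kt).d * (((F.P Kt).L - 1) / 2)) + 5) * (F.P Kt).L ^ k ∧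
        (walkEnd (root b.src) w = embIter i c.src ∨ walkEnd (root b.src) w = embIter i c.tgt)) →
      dist1 (Averaging.iter (fun i => blockAvg (P := F.P Kt) (j := i) (expMeanLogSU (n := Fin 2))) i U₀ c) ≤ ρn := fun i hi c hc hw => by
    have hc' := h𝔹'sub i c hc
    have hagree : avgFamily (Node00.avOfRecord F 2 Kt) U₀ i c = avgFamily (Node00.avOfRecord F 2 Kt) (qsstarGIter0 k W) i c := hmin.2.1 i c hc'
    show dist1 (avgFamily (Node00.avOfRecord F 2 Kt) U₀ i c) ≤ ρn
    rw [hagree]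
    exact hWj i hi c hc' hw
  -- ### the graded root chain of `b`; its links are members of the sub-family
  obtain ⟨J', -, hJ'⟩ := hcov_Bj hM hk1 hk hdiv (Z := Z) b.tgt
  obtain ⟨links, hlen, hmem, hgrade, hend, hcons⟩ := exists_rootChain_Bj_graded hk hk1 hM2 hdiv root hcentre b hbs hbt hJ hJ'
  have hmem' : ∀ l ∈ links, l.1 ≤ k ∧ l.2.1 ∈ bondsOf (𝔹' l.1) := by
    intro l hl
    obtain ⟨hlk, hlB⟩ := hmem l hl
    refine ⟨hlk, ?_⟩
    obtain ⟨s, t, hst⟩ := List.append_of_mem hl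
    have hcst := hcons s t l hst
    -- the prefix word from `root b₋` to an end centre `e` of the link
    have hlenS : ((s.map fun l => List.replicate ((F.P Kt).L ^ l.1) (l.2.1.dir, l.2.2)).flatten).length ≤ (3 * ((F.P Kt).d * (((F.P Kt).L - 1) / 2)) + 5) * (F.P Kt).L ^ k := by
      refine le_trans (N12BlockChains.length_flatten_le_of_forall_le _ s fun l' hl' => ?_) (le_trans (Nat.mul_le_mul_right _ ?_) (Nat.mul_le_mul_right _ hlen))
      · rw [List.length_replicate]; exact Nat.pow_le_pow_right (F.P Kt).L_pos (hmem l' (by rw [hst]; simp [hl'])).1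
      · have := congrArg List.length hst; simp only [List.length_append, List.length_cons] at this; omega
    have hreach : ∃ e : Site (F.P Kt) l.1, (e = l.2.1.src ∨ e = l.2.1.tgt) ∧
        walkEnd (root b.src) ((s.map fun l => List.replicate ((F.P Kt).L ^ l.1) (l.2.1.dir, l.2.2)).flatten) = embIter l.1 e := by
      cases h2 : l.2.2
      · exact ⟨_, Or.inr rfl, hcst.2 h2⟩
      · exact ⟨_, Or.inl rfl, hcst.1 h2⟩
    obtain ⟨e, he, hwe⟩ := hreach
    -- the end of the link that belongs to `𝐁_k(Z)`
    have hyex : ∃ y : Site (F.P Kt) l.1, (y = l.2.1.src ∨ y = l.2.1.tgt) ∧ y ∈ (Bj ν.M₁ Z k : DetSet (F.P Kt)) l.1 := by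
      rcases hlB with h | h
      · exact ⟨_, Or.inl rfl, h⟩
      · exact ⟨_, Or.inr rfl, h⟩
    obtain ⟨y, hy, hyB⟩ := hyex
    obtain ⟨u, hul, hue⟩ := exists_word_endpoints l.2.1 he hy
    have hy𝔹 : y ∈ 𝔹' l.1 := by
      refine ⟨hyB, b.src, hbX, wr ++ ((s.map fun l => List.replicate ((F.P Kt).L ^ l.1) (l.2.1.dir, l.2.2)).flatten) ++ u, ?_, ?_⟩
      · rw [List.length_append, List.length_append, hR₃]
        have hu' : u.length ≤ (F.P Kt).L ^ k := hul.trans (Nat.pow_le_pow_right (F.P Kt).L_pos hlk)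
        omega
      · rw [walkEnd_append, walkEnd_append, hwre, hwe, hue]
    rcases hy with rfl | rfl
    · exact Or.inl hy𝔹
    · exact Or.inr hy𝔹
  -- ### the transporter of the chain (dag-n12-w3), with the window-near sub-family and the graded budgets
  have hR : links.length * (F.P Kt).L ^ min (J + 1) k ≤ (3 * ((F.P Kt).d * (((F.P Kt).L - 1) / 2)) + 5) * (F.P Kt).L ^ k :=
    Nat.mul_le_mul hlen (Nat.pow_le_pow_right (F.P Kt).L_pos (min_le_right _ _))
  obtain ⟨g, hH, hg, hl⟩ := transporter_of_links_local (expMeanLogSU (n := Fin 2)) U₀ κ θ hθ0 hθ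
    (fun i hi => hθmono i _ hi) 𝔹' hκ' (root b.src) links hmem' (fun l hl => le_min (hgrade l hl).1 (hmem l hl).1) hcons hR hδ₁'
  have hθN : θ (min (J + 1) k) ≤ 24 * ((((((F.P Kt).d + 2) * (F.P Kt).L : ℕ) : ℝ) ^ 2 / 4) * ε) := (hθmono _ _ (min_le_right _ _)).trans hθk
  have hθN0 : 0 ≤ θ (min (J + 1) k) := hθ0.trans (hθmono 0 _ (Nat.zero_le _))
  have hlenR : (links.length : ℝ) ≤ ((3 * ((F.P Kt).d * (((F.P Kt).L - 1) / 2)) + 5 : ℕ) : ℝ) := by exact_mod_cast hlen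
  have hm0 : (0 : ℝ) ≤ ((3 * ((F.P Kt).d * (((F.P Kt).L - 1) / 2)) + 5 : ℕ) : ℝ) := Nat.cast_nonneg _
  refine ⟨_, g, hend, hl.trans (Nat.mul_le_mul_right _ hlen), hH.trans ?_, hg.trans (mul_le_mul_of_nonneg_right hlenR hρn)⟩
  calc (links.length : ℝ) * θ (min (J + 1) k) ≤ ((3 * ((F.P Kt).d * (((F.P Kt).L - 1) / 2)) + 5 : ℕ) : ℝ) * θ (min (J + 1) k) :=
        mul_le_mul_of_nonneg_right hlenR hθN0
    _ ≤ ((3 * ((F.P Kt).d * (((F.P Kt).L - 1) / 2)) + 5 : ℕ) : ℝ) * (24 * ((((((F.P Kt).d + 2) * (F.P Kt).L : ℕ) : ℝ) ^ 2 / 4) * ε)) :=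
        mul_le_mul_of_nonneg_left hθN hm0

end Summit.QuantumFields.YangMills.BalabanUVNodes.N12WindowGradedLetters

end
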